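import Summits.NavierStokesRegularity.FunctionalMining.NoGo.TopBotEigHeatCoerciveSplit
import Summits.NavierStokesRegularity.FunctionalMining.NoGo.TopBotEigSplitting
import HarnessLib

/-!
# FunctionalMining / NoGo — K10d: door D-K6 (c) for EVERY REAL `q > 2` — `TopBotEigHeatCoercivePos q`
# (the corollary K9 ∘ K10c), with the explicit rate `shareConst q · q / (2 · npConst q)` and the value at `q = 4`

HONEST FRAMING. Search for candidate a priori estimates; no regularity claim. Nothing about Navier–Stokes is
proved or asserted here: the file composes two kernel items — the heat-flow half K9
`NoGo/TopBotEigHeatCoerciveSplit` (`topBotEigHeatCoercivePos_of_splitting (hq : 2 < q) (hc : 0 < c)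
(hS : TopBotEigSplitting q c) : TopBotEigHeatCoercivePos q`, a STATIC heat-flow inequality for smooth
divergence-free fields on the flat torus behind a typed finite-dimensional hypothesis) and the finite-dimensional
half K10c `NoGo/TopBotEigSplitting` (`topBotEigSplitting_shareConst (hq : 2 ≤ q)` = that hypothesis at the share
`c = shareConst q > 0`, proved). Cell `pub-nsfunc`, no-go seat (gen 38). File K10d of the K10 set; imports the filed
K9 and K10c (itself importing K10b ← K10a).

WHAT IS PROVED HERE [ours; three-line corollaries]:
* `TopEig.topBotEigSplitting_pos (hq : 2 ≤ q) : ∃ c, 0 < c ∧ TopBotEigSplitting q c` (K10c in K9ʼs vocabulary —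
  the written-out statement of K10c IS `TopBotEigSplitting`, definitionally);
* `TopEig.topBotEigMoment_heatCoercive_shareConst (hq : 2 < q) :
  HeatCoercive (topBotEigMoment q) (shareConst q * q / (2 * npConst q))` — the symmetrised core `Φ_q + Ψ_q` is
  heat-coercive with an EXPLICIT (far from sharp) rate;
* **`TopEig.topBotEigHeatCoercivePos_of_two_lt (hq : 2 < q) : TopBotEigHeatCoercivePos (d := Fin 3) q`** — the
  `@[conjecture]` node of `SpectralMixtureCandidates.lean` HOLDS for every real `q > 2` (at `q = 2` it holds by
  K7 `NoGo/TopBotEigHeatCoerciveTwo.topBotEigHeatCoercivePos_two`, sharp window `[8π²/3, 8π²]` by K8 / the window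
  file; `3/2 < q < 2` is OPEN — door (b));
* by value: `ceilC 4 = 37`, `floorC 4 = 1/27`, `shareConst 4 = 1/999`, `TopBotEigSplitting 4 (1/999)`,
  `TopBotEigHeatCoercivePos 4`, `HeatCoercive (topBotEigMoment 4) (1/999 * 4 / (2 * npConst 4))`.

WHAT IS NOT PROVED HERE. Any sharp share or rate for `q > 2` (census-2 / dict float screens conjecture the share
threshold `c_axi(q) = 6^{−q/2}(2^q + 1 − F₊(q))`, e.g. `2/9` at `q = 4`; ours is `1/999`); anything for `q ≤ 2`.

PROVENANCE / STATUS. Typed by the no-go seat (gen 38); farm-checked as the concatenation K10a+b+c + this body with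
the TREE K9 imported (evidence `pub-nsfunc-nogo/sieveld/ktg/`, `K10.CONCAT-ABCD.lean`), and inside the K9∘K10 JOINT
file; STATUS: STAGED (`pub-nsfunc-nogo/NoGo/TopBotEigHeatCoerciveGtTwo.STAGING.lean`), to be filed LAST of the K10
set (after K10a → K10b → K10c) by a prove seat on the leadʼs word. Search for candidate a priori estimates; no
regularity claim. [ours; K1-Q6 (c) = door D-K6 (c), `q > 2`]
FILING (prove seat g26, REQUEST #24d): declarations byte-identical to the no-go seat's staged `TopBotEigHeatCoerciveGtTwo.STAGING.lean` 444f5288e6066e93; this line is the only addition.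
-/

noncomputable section

namespace Summit.NavierStokesRegularity.FunctionalMining

namespace TopEig

/-- K10c in K9ʼs vocabulary: a positive share exists for every real `q ≥ 2`. [ours] -/
theorem topBotEigSplitting_pos {q : ℝ} (hq : 2 ≤ q) : ∃ c : ℝ, 0 < c ∧ TopBotEigSplitting q c :=
  topBotEigSplitting_exists hq

/-- The splitting at the explicit share `shareConst q`. [ours] -/
theorem topBotEigSplitting_of_shareConst {q : ℝ} (hq : 2 ≤ q) : TopBotEigSplitting q (shareConst q) :=
  topBotEigSplitting_shareConst hq

/-- **Heat coercivity of the symmetrised core `Φ_q + Ψ_q` with an explicit rate**, every real `q > 2`. [ours] -/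
theorem topBotEigMoment_heatCoercive_shareConst {q : ℝ} (hq : 2 < q) :
    HeatCoercive (d := Fin 3) (topBotEigMoment q) (shareConst q * q / (2 * npConst q)) :=
  topBotEigMoment_heatCoercive_of_splitting hq (shareConst_pos hq.le).le (topBotEigSplitting_shareConst hq.le)

/-- **Door D-K6 (c) for every real `q > 2`: `TopBotEigHeatCoercivePos q`.** [ours; K9 ∘ K10c] -/
theorem topBotEigHeatCoercivePos_of_two_lt {q : ℝ} (hq : 2 < q) :
    TopBotEigHeatCoercivePos (d := Fin 3) q :=
  topBotEigHeatCoercivePos_of_splitting hq (shareConst_pos hq.le) (topBotEigSplitting_shareConst hq.le)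

/-! ### By value at `q = 4` -/

/-- `ceilC 4 = 37`. [ours; arithmetic] -/
theorem ceilC_four : ceilC 4 = 37 := by
  rw [ceilC, show (4 : ℝ) / 2 - 2 = 0 by norm_num, show (4 : ℝ) / 2 - 1 = 1 by norm_num,
    Real.rpow_zero, Real.rpow_zero, Real.rpow_one]
  norm_num

/-- `floorC 4 = 1/27`. [ours; arithmetic] -/
theorem floorC_four : floorC 4 = 1 / 27 := by
  rw [floorC, show (4 : ℝ) / 2 - 1 = 1 by norm_num, Real.rpow_one]; norm_num

/-- `shareConst 4 = 1/999`. [ours; arithmetic] -/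
theorem shareConst_four : shareConst 4 = 1 / 999 := by
  rw [shareConst, floorC_four, ceilC_four, show (4 : ℝ) / 2 = (2 : ℕ) by norm_num,
    Real.rpow_natCast]
  norm_num

/-- `TopBotEigSplitting 4 (1/999)`. [ours] -/
theorem topBotEigSplitting_four : TopBotEigSplitting 4 (1 / 999) := by
  rw [← shareConst_four]; exact topBotEigSplitting_shareConst (by norm_num)

/-- `TopBotEigHeatCoercivePos 4`. [ours] -/
theorem topBotEigHeatCoercivePos_four : TopBotEigHeatCoercivePos (d := Fin 3) 4 :=
  topBotEigHeatCoercivePos_of_two_lt (by norm_num)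

/-- `HeatCoercive (Φ₄ + Ψ₄) ((1/999)·4/(2·npConst 4))`. [ours] -/
theorem topBotEigMoment_heatCoercive_four :
    HeatCoercive (d := Fin 3) (topBotEigMoment 4) (1 / 999 * 4 / (2 * npConst 4)) := by
  rw [← shareConst_four]; exact topBotEigMoment_heatCoercive_shareConst (by norm_num)

end TopEig

end Summit.NavierStokesRegularity.FunctionalMining
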